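import Literature.AlgebraicGeometry.HodgeTheory.MotivatedClassesDeformationInputs
import Literature.AlgebraicGeometry.HodgeTheory.QuasiProjectiveOfAffine
import Literature.AlgebraicGeometry.Motives.CurveThroughTwoPoints
import HarnessLib

/-!
# André's deformation theorem (1996, Thm. 0.5): the curve input (A0) from Mumford's lemma

Family `hodge`, layer `Literature/AlgebraicGeometry/HodgeTheory`. Fourth proof file of the unit
`Andre1996_deformation` (Y. André, *Pour une théorie inconditionnelle des motifs*, Publ. Math. IHÉS 83
(1996), Thm. 0.5; named fact in `MotivatedClasses.lean`; proof files `MotivatedClassesDeformation.lean`,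
`MotivatedClassesDeformationInputs.lean`, `MotivatedClassesTransport.lean`).
`Andre1996_deformation_of_published_inputs` (`MotivatedClassesDeformationInputs`) proves the named fact
from FIVE classical inputs (A0) curves on affine pieces, (A1) Hironaka, (A2) Deligne's théorème de la
partie fixe, (A3) André's Thm. 0.4, (A5) André's Prop. 2.1. Here the input

> (A0) "Soient `s`, `t` deux points de `S(ℂ)`. Il existe une variété affine lisse connexe `S'` (par
> exemple une courbe) et un morphisme `S' → S` tel que l'image de `S'(ℂ)` dans `S(ℂ)` contienne `s`
> et `t`" (§5.1, p. 25)

is DISCHARGED from the tree's named fact `Motives.mumford_smoothCurve_through_two_points` (Mumford,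
*Abelian Varieties* §6, Lemma: two points of an irreducible variety lie on an irreducible curve,
normalised; `Motives/CurveThroughTwoPoints`) and the PROVED quasi-projectivity of affine
`ℂ`-schemes of finite type (`IsQuasiProjectiveOver.of_isAffine`, `QuasiProjectiveOfAffine`):

* `Andre1996_deformation_hcurve` — for an affine `ℂ`-scheme `S` locally of finite type, a closed
  irreducible `Z ⊆ S` and complex points `s`, `t` on `Z`, there are a smooth irreducible
  quasi-projective `S'`, `g : S' ⟶ S` and `s', t' ∈ S'(ℂ)` over `s`, `t`: for `s ≠ t` the smooth
  irreducible affine curve of Mumford's lemma (quasi-projective, being affine of finite type), for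
  `s = t` the point `S' = Spec ℂ` mapped to `s`;
* `Andre1996_deformation_of_four_inputs` — **André's Théorème 0.5 from Mumford's lemma and the FOUR
  inputs (A1), (A2), (A3), (A5)**.

## References

* [Andre1996Motifs] Y. André, Pour une théorie inconditionnelle des motifs, Publ. Math. IHÉS 83
  (1996), Thm. 0.5 and §5.1 (p. 25).
* [MumfordAV1970] D. Mumford, Abelian Varieties (1970), §6, Lemma.
-/

noncomputable section

open CategoryTheory AlgebraicGeometry MonoidalCategory CartesianMonoidalCategory
open Literature.AlgebraicGeometry.Motives

namespace Literature.AlgebraicGeometry.HodgeTheory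

/-- `Spec ℂ → Spec ℂ` (the structure morphism of `Motives.specOver ℂ ℂ`) is the identity. [folklore] -/
theorem specOver_hom_eq_id : (Motives.specOver ℂ ℂ).hom = 𝟙 _ := by
  change Spec.map (CommRingCat.ofHom (algebraMap ℂ ℂ)) = 𝟙 _
  rw [show CommRingCat.ofHom (algebraMap ℂ ℂ) = 𝟙 _ from rfl, Spec.map_id]

/-- **Input (A0) of André's §5.1, discharged**: granted Mumford's lemma
(`Motives.mumford_smoothCurve_through_two_points`), two complex points `s`, `t` on a closed irreducible
subset `Z` of an affine `ℂ`-scheme `S` locally of finite type lie in the image of a smooth irreducible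
QUASI-PROJECTIVE `ℂ`-scheme `S' ⟶ S` — for `s ≠ t` the smooth irreducible affine curve through them
(quasi-projective by `IsQuasiProjectiveOver.of_isAffine`), for `s = t` the point `Spec ℂ ⟶ S` at `s`.
This is the hypothesis `hcurve` of `Andre1996_deformation_of_published_inputs`, verbatim.
[cite: Andre1996Motifs, §5.1 (p. 25)] [cite: MumfordAV1970, §6, Lemma] -/
theorem Andre1996_deformation_hcurve (hM : Motives.mumford_smoothCurve_through_two_points)
    (S : Motives.SchemeOver ℂ) (hS : IsAffine S.left) (hft : LocallyOfFiniteType S.hom)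
    (Z : Set S.left) (hZc : IsClosed Z) (hZ : IsIrreducible Z) (s t : Motives.ComplexPoints S)
    (hs : s.pt ∈ Z) (ht : t.pt ∈ Z) :
    ∃ (S' : Motives.SchemeOver ℂ) (g : S' ⟶ S) (s' t' : Motives.ComplexPoints S'),
      AlgebraicGeometry.Smooth S'.hom ∧ IsQuasiProjectiveOver S' ∧ IrreducibleSpace S'.left ∧
        Motives.AlgPoints.map g s' = s ∧ Motives.AlgPoints.map g t' = t := by
  by_cases hst : s = t
  · -- `S' = Spec ℂ`, `g = s`
    subst hst
    refine ⟨Motives.specOver ℂ ℂ, s, 𝟙 _, 𝟙 _, ?_, IsQuasiProjectiveOver.specOver, ?_,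
      Category.id_comp _, Category.id_comp _⟩
    · haveI : IsIso (Motives.specOver ℂ ℂ).hom := by
        rw [specOver_hom_eq_id]
        exact IsIso.id _
      infer_instance
    · exact inferInstanceAs (IrreducibleSpace (PrimeSpectrum ℂ))
  · -- the smooth irreducible affine curve of Mumford's lemma
    obtain ⟨C, g, s', t', hCaff, hCirr, hCsm, -, -, hs', ht'⟩ := hM hS hft Z hZc hZ s t hs ht hst
    haveI := hCaff
    haveI := hCsm
    exact ⟨C, g, s', t', hCsm, IsQuasiProjectiveOver.of_isAffine C, hCirr, hs', ht'⟩

/-- **André's Théorème 0.5 from Mumford's lemma and FOUR classical inputs** —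
`Andre1996_deformation_of_published_inputs` with its curve hypothesis (A0) discharged by
`Andre1996_deformation_hcurve`. Remaining hypotheses, verbatim as there: `hHir` (A1, Hironaka: a smooth
quasi-projective irreducible complex variety is an open subscheme of a smooth projective variety of the
same dimension), `hD` (A2, Deligne's théorème de la partie fixe, the named fact
`deligne_globalInvariantCycles`), `h04` (A3, André's Thm. 0.4 in the form used in §5.1), `h21` (A5,
André's Prop. 2.1 (ii): `A_mot` is stable under pull-backs); plus the named fact
`Motives.mumford_smoothCurve_through_two_points`. [cite: Andre1996Motifs, Thm. 0.5 (p. 8) and §5.1 (p. 25)]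
[cite: MumfordAV1970, §6, Lemma] -/
theorem Andre1996_deformation_of_four_inputs (hM : Motives.mumford_smoothCurve_through_two_points)
    (hHir : ∀ (m : ℕ) (X : Motives.SchemeOver ℂ), SmoothOfRelativeDimension m X.hom →
      IsQuasiProjectiveOver X → IrreducibleSpace X.left →
      ∃ (Xbar : Motives.SchemeOver ℂ) (i : X ⟶ Xbar),
        Motives.IsSmoothProjective m Xbar ∧ IsOpenImmersion i.left)
    (hD : deligne_globalInvariantCycles)
    (h04 : ∀ ⦃m n : ℕ⦄ ⦃Xbar X : Motives.SchemeOver ℂ⦄ (j : X ⟶ Xbar),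
      Motives.IsSmoothProjective m Xbar → Motives.IsSmoothProjective n X →
      ∀ (p : ℕ) (Ā : complexBetti Xbar (2 * p)),
        complexBetti.map j (2 * p) Ā ∈ motivatedClasses n X p →
        ∃ Ā' ∈ motivatedClasses m Xbar p, complexBetti.map j (2 * p) Ā' = complexBetti.map j (2 * p) Ā)
    (h21 : ∀ ⦃m n : ℕ⦄ ⦃Xbar X : Motives.SchemeOver ℂ⦄ (j : X ⟶ Xbar),
      Motives.IsSmoothProjective m Xbar → Motives.IsSmoothProjective n X →
      ∀ (p : ℕ), ∀ Ā' ∈ motivatedClasses m Xbar p,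
        complexBetti.map j (2 * p) Ā' ∈ motivatedClasses n X p) :
    Andre1996_deformation :=
  Andre1996_deformation_of_published_inputs (Andre1996_deformation_hcurve hM) hHir hD h04 h21

end Literature.AlgebraicGeometry.HodgeTheory

end
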